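import Literature.AlgebraicGeometry.Crystalline.HodgeDeRhamDegeneration
import Literature.AlgebraicGeometry.Crystalline.DeRhamComplexRestriction
import Literature.AlgebraicGeometry.Crystalline.DeRhamComplexBaseChange
import Literature.AlgebraicGeometry.Motives.WittSchemeGenericFibre
import Literature.Topology.SheafOpenRestriction
import Literature.Algebra.Homology.MapExtend
import Literature.Algebra.Homology.StupidFiltrationRestrict
import HarnessLib

/-!
# `HodgeDeRhamDegeneratesModTorsion`: reduction to the generic fibre

The named fact `HodgeDeRhamDegeneratesModTorsion` (`HodgeDeRhamDegeneration.lean`,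
[Deligne1968, Thm. 5.5 (ii)]) says that for a smooth proper `𝒳/W(k)` the connecting maps
`δ : ℍ^{k₀}(𝒳, σ≤n₀ Ω•_{𝒳/W}) → ℍ^{k₀+1}(𝒳, Ωⁿ¹[-n₁])` of the stupid filtration have torsion image.
Its docstring describes the proof as "Deligne's `E₁`-degeneration for the generic fibre `X_K/K`
transported by flat base change `W → K`". This file PROVES the transport, reducing the fact to two
hypotheses stated on the generic fibre (`hodgeDeRhamDegeneratesModTorsion_of_genericFibre`):

* (H1) the stupid-filtration connecting maps of `Ω•_{𝒳[1/p]/K}` on the open subscheme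
  `𝒳[1/p] = D(p) ⊆ 𝒳` (a smooth proper `K`-scheme, `K = W(k)[1/p]` of characteristic `0`) have
  torsion image — Deligne's theorem proper;
* (H2) the restriction `ℍ^{k₁}(𝒳, Ωⁿ¹_{𝒳/W}[-n₁]) → ℍ^{k₁}(𝒳[1/p], Ωⁿ¹_{𝒳[1/p]/K}[-n₁])` has
  torsion kernel — cohomology and localization (`H(𝒳, F)[1/p] = H(𝒳[1/p], F)`).

The glue assembled here, all proved in the tree: the restriction functor to an open is exact and
preserves constant sheaves (`Topology/SheafOpenRestriction`); hyper-Ext is functorial along exact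
functors, changes of the first argument and morphisms of complexes, compatibly with the connecting
maps of the stupid filtration (`Algebra/Homology/HyperExtExactFunctor`, `HyperExtComap`,
`StupidFiltrationFunctor`, `StupidFiltrationExactFunctor`, `StupidFiltrationRestrict`,
`MapExtend`); the de Rham complex restricts to opens (`DeRhamComplexRestriction`) and is insensitive
to localizing the base (`DeRhamComplexBaseChange`, Stacks 00RT); `𝒳[1/p]` is the generic fibre, a
`K`-scheme (`Motives/WittSchemeGenericFibre`, `Motives/BaseBasicOpenOver`).

## Main statements

* `OpenReduction.exists_smul_delta_eq_zero` — for any open `U ⊆ 𝒳` and comparison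
  `Ω•_{𝒳/R}|_U ⟶ L`: torsion image for `L` + torsion kernel of the restriction ⇒ torsion image
  for `Ω•_{𝒳/R}`;
* `hodgeDeRhamDegeneratesModTorsion_of_openReduction` — the same, with the conclusion literally
  `HodgeDeRhamDegeneratesModTorsion`;
* `genericDeRhamIso` — `Ω•_{𝒳/W}|_{𝒳[1/p]} ≅ Ω•_{𝒳[1/p]/K}`;
* `hodgeDeRhamDegeneratesModTorsion_of_genericFibre` — (H1) ∧ (H2) ⇒
  `HodgeDeRhamDegeneratesModTorsion`.

## References

* P. Deligne, Théorème de Lefschetz et critères de dégénérescence de suites spectrales, Publ. Math.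
  IHÉS 35 (1968), Thm. 5.5. [Deligne1968]
* The Stacks project, Tag 00RT. [StacksProject]
* R. Hartshorne, *Algebraic Geometry*, III.9.3 (flat base change). [Hartshorne1977]

No named facts are introduced; (H1), (H2) are hypotheses of the final theorem.
-/

noncomputable section

open CategoryTheory Limits CochainComplex TopologicalSpace AlgebraicGeometry

-- As in `HodgeDeRhamDegeneration.lean`: `HasHyperExt` / `IsStrictlyGE` searches for sheaf
-- categories need a larger budget.
set_option synthInstance.maxHeartbeats 200000

namespace Literature.AlgebraicGeometry.Crystalline

open Literature.AlgebraicGeometry.Motives Literature.AlgebraicGeometry.Motives.WittScheme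
  Literature.Algebra.Homology Literature.Topology

namespace OpenReduction

variable {R : Type} [CommRing R] (𝒳 : SchemeOver R) (U : 𝒳.left.Opens)

/-- The constant sheaf `ℤ` on a space (the first argument of sheaf hypercohomology as hyper-Ext, as
in `HodgeDeRhamDegeneratesModTorsion`). [folklore] -/
def zConst (X : TopCat.{0}) : Sheaf (Opens.grothendieckTopology X) AddCommGrpCat.{0} :=
  (constantSheaf (Opens.grothendieckTopology X) AddCommGrpCat.{0}).obj
    (AddCommGrpCat.of (ULift.{0} ℤ))

/-- The `ℤ`-extended algebraic de Rham complex `Ω•_{𝒳/R}` (as in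
`HodgeDeRhamDegeneratesModTorsion`). [folklore] -/
def extDeRham :
    CochainComplex (Sheaf (Opens.grothendieckTopology 𝒳.left.carrier) AddCommGrpCat.{0}) ℤ :=
  (algebraicDeRhamComplex 𝒳).extend ComplexShape.embeddingUpNat

/-- `Ω•_{𝒳/R}` (extended to `ℤ`) is strictly in degrees `≥ 0`. [folklore] -/
instance : CochainComplex.IsStrictlyGE (extDeRham 𝒳) 0 := by
  unfold extDeRham; infer_instance

/-- The restriction functor `Sh(𝒳) ⥤ Sh(U)` to the open `U` (`Topology.restrict`). [folklore] -/
abbrev res : Sheaf (Opens.grothendieckTopology 𝒳.left.carrier) AddCommGrpCat.{0} ⥤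
    Sheaf (Opens.grothendieckTopology ((Opens.toTopCat 𝒳.left.carrier).obj U)) AddCommGrpCat.{0} :=
  restrict U.isOpenEmbedding AddCommGrpCat.{0}

/-- Restriction is additive (`Topology.additive_restrict`). [folklore] -/
instance : (res 𝒳 U).Additive := additive_restrict _

/-- Restriction is left exact (`Topology.preservesFiniteLimits_restrict`). [folklore] -/
instance : PreservesFiniteLimits (res 𝒳 U) := preservesFiniteLimits_restrict _

/-- Restriction is right exact (`Topology.preservesFiniteColimits_restrict`). [folklore] -/
instance : PreservesFiniteColimits (res 𝒳 U) := preservesFiniteColimits_restrict _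

/-- `ℤ_𝒳|_U ≅ ℤ_U` (`Topology.restrictConstantSheafIso`). [folklore] -/
def resZConstIso : (res 𝒳 U).obj (zConst 𝒳.left.carrier) ≅
    zConst ((Opens.toTopCat 𝒳.left.carrier).obj U) :=
  (restrictConstantSheafIso U.isOpenEmbedding).app (AddCommGrpCat.of (ULift.{0} ℤ))

variable (L : CochainComplex
    (Sheaf (Opens.grothendieckTopology ((Opens.toTopCat 𝒳.left.carrier).obj U))
      AddCommGrpCat.{0}) ℕ)
  (gU : ((res 𝒳 U).mapHomologicalComplex (ComplexShape.up ℕ)).obj (algebraicDeRhamComplex 𝒳) ⟶ L)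

/-- The `ℤ`-extension of an `ℕ`-indexed complex `L` on `U`. [folklore] -/
def extOf : CochainComplex
    (Sheaf (Opens.grothendieckTopology ((Opens.toTopCat 𝒳.left.carrier).obj U))
      AddCommGrpCat.{0}) ℤ :=
  L.extend ComplexShape.embeddingUpNat

/-- `extOf L` is strictly in degrees `≥ 0`. [folklore] -/
instance : CochainComplex.IsStrictlyGE (extOf 𝒳 U L) 0 := by
  unfold extOf; infer_instance

/-- The comparison morphism `Ω•_{𝒳/R}|_U ⟶ L` extended to `ℤ`-complexes
(`Homology.mapExtendIso` followed by `extendMap gU`). [folklore] -/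
def resMap :
    ((res 𝒳 U).mapHomologicalComplex (ComplexShape.up ℤ)).obj (extDeRham 𝒳) ⟶ extOf 𝒳 U L :=
  (mapExtendIso (res 𝒳 U) (algebraicDeRhamComplex 𝒳) ComplexShape.embeddingUpNat).hom ≫
    HomologicalComplex.extendMap gU ComplexShape.embeddingUpNat

variable (n₀ n₁ : ℤ) (h : n₀ + 1 = n₁)

/-- `Kⁿ¹[-n₁]` is strictly `≥ n₁`. [folklore] -/
instance isStrictlyGE_X₁ {C : Type*} [Category C] [Abelian C] (K : CochainComplex C ℤ) :
    CochainComplex.IsStrictlyGE (stupidFiltrationShortComplex K n₀ n₁ h).X₁ n₁ :=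
  (inferInstance : CochainComplex.IsStrictlyGE ((CochainComplex.singleFunctor _ n₁).obj _) n₁)

/-- `σ≤n₀ K` is strictly `≥ 0` when `K` is. [folklore] -/
instance isStrictlyGE_X₃ {C : Type*} [Category C] [Abelian C] (K : CochainComplex C ℤ)
    [CochainComplex.IsStrictlyGE K 0] :
    CochainComplex.IsStrictlyGE (stupidFiltrationShortComplex K n₀ n₁ h).X₃ 0 :=
  (inferInstance : CochainComplex.IsStrictlyGE (stupidTruncLE K n₀) 0)

/-- Smallness of hyper-Ext (`Homology.hasHyperExt_of_isGE`), keyed for instance search (the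
generic `IsGE 0` instance does not see through `stupidFiltrationShortComplex`; priority above it).
[folklore] -/
instance (priority := 20000) : HasHyperExt.{0} (zConst 𝒳.left.carrier)
    (stupidFiltrationShortComplex (extDeRham 𝒳) n₀ n₁ h).X₁ :=
  hasHyperExt_of_isGE _ _ n₁

/-- Smallness of hyper-Ext (`Homology.hasHyperExt_of_isGE`), keyed for instance search (the
generic `IsGE 0` instance does not see through `stupidFiltrationShortComplex`; priority above it).
[folklore] -/
instance (priority := 20000) : HasHyperExt.{0} (zConst 𝒳.left.carrier)
    (stupidFiltrationShortComplex (extDeRham 𝒳) n₀ n₁ h).X₃ :=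
  hasHyperExt_of_isGE _ _ 0

/-- Smallness of hyper-Ext (`Homology.hasHyperExt_of_isGE`), keyed for instance search (the
generic `IsGE 0` instance does not see through `stupidFiltrationShortComplex`; priority above it).
[folklore] -/
instance (priority := 20000) : HasHyperExt.{0} ((res 𝒳 U).obj (zConst 𝒳.left.carrier))
    (((res 𝒳 U).mapHomologicalComplex (ComplexShape.up ℤ)).obj
      (stupidFiltrationShortComplex (extDeRham 𝒳) n₀ n₁ h).X₁) :=
  haveI : CochainComplex.IsStrictlyGE (((res 𝒳 U).mapHomologicalComplex (ComplexShape.up ℤ)).obj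
      (stupidFiltrationShortComplex (extDeRham 𝒳) n₀ n₁ h).X₁) n₁ :=
    (inferInstance : CochainComplex.IsStrictlyGE (((res 𝒳 U).mapHomologicalComplex
      (ComplexShape.up ℤ)).obj ((CochainComplex.singleFunctor _ n₁).obj _)) n₁)
  hasHyperExt_of_isGE _ _ n₁

/-- Smallness of hyper-Ext (`Homology.hasHyperExt_of_isGE`), keyed for instance search (the
generic `IsGE 0` instance does not see through `stupidFiltrationShortComplex`; priority above it).
[folklore] -/
instance (priority := 20000) : HasHyperExt.{0} ((res 𝒳 U).obj (zConst 𝒳.left.carrier))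
    (((res 𝒳 U).mapHomologicalComplex (ComplexShape.up ℤ)).obj
      (stupidFiltrationShortComplex (extDeRham 𝒳) n₀ n₁ h).X₃) :=
  haveI : CochainComplex.IsStrictlyGE (((res 𝒳 U).mapHomologicalComplex (ComplexShape.up ℤ)).obj
      (stupidFiltrationShortComplex (extDeRham 𝒳) n₀ n₁ h).X₃) 0 :=
    (inferInstance : CochainComplex.IsStrictlyGE (((res 𝒳 U).mapHomologicalComplex
      (ComplexShape.up ℤ)).obj (stupidTruncLE (extDeRham 𝒳) n₀)) 0)
  hasHyperExt_of_isGE _ _ 0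

/-- Smallness of hyper-Ext (`Homology.hasHyperExt_of_isGE`), keyed for instance search (the
generic `IsGE 0` instance does not see through `stupidFiltrationShortComplex`; priority above it).
[folklore] -/
instance (priority := 20000) : HasHyperExt.{0} ((res 𝒳 U).obj (zConst 𝒳.left.carrier))
    (stupidFiltrationShortComplex (((res 𝒳 U).mapHomologicalComplex (ComplexShape.up ℤ)).obj
      (extDeRham 𝒳)) n₀ n₁ h).X₁ :=
  hasHyperExt_of_isGE _ _ n₁

/-- Smallness of hyper-Ext (`Homology.hasHyperExt_of_isGE`), keyed for instance search (the
generic `IsGE 0` instance does not see through `stupidFiltrationShortComplex`; priority above it).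
[folklore] -/
instance (priority := 20000) : HasHyperExt.{0} ((res 𝒳 U).obj (zConst 𝒳.left.carrier))
    (stupidFiltrationShortComplex (((res 𝒳 U).mapHomologicalComplex (ComplexShape.up ℤ)).obj
      (extDeRham 𝒳)) n₀ n₁ h).X₃ :=
  hasHyperExt_of_isGE _ _ 0

/-- Smallness of hyper-Ext (`Homology.hasHyperExt_of_isGE`), keyed for instance search (the
generic `IsGE 0` instance does not see through `stupidFiltrationShortComplex`; priority above it).
[folklore] -/
instance (priority := 20000) : HasHyperExt.{0} ((res 𝒳 U).obj (zConst 𝒳.left.carrier))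
    (stupidFiltrationShortComplex (extOf 𝒳 U L) n₀ n₁ h).X₁ :=
  hasHyperExt_of_isGE _ _ n₁

/-- Smallness of hyper-Ext (`Homology.hasHyperExt_of_isGE`), keyed for instance search (the
generic `IsGE 0` instance does not see through `stupidFiltrationShortComplex`; priority above it).
[folklore] -/
instance (priority := 20000) : HasHyperExt.{0} ((res 𝒳 U).obj (zConst 𝒳.left.carrier))
    (stupidFiltrationShortComplex (extOf 𝒳 U L) n₀ n₁ h).X₃ :=
  hasHyperExt_of_isGE _ _ 0

/-- Smallness of hyper-Ext (`Homology.hasHyperExt_of_isGE`), keyed for instance search (the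
generic `IsGE 0` instance does not see through `stupidFiltrationShortComplex`; priority above it).
[folklore] -/
instance (priority := 20000) : HasHyperExt.{0} (zConst ((Opens.toTopCat 𝒳.left.carrier).obj U))
    (stupidFiltrationShortComplex (extOf 𝒳 U L) n₀ n₁ h).X₁ :=
  hasHyperExt_of_isGE _ _ n₁

/-- Smallness of hyper-Ext (`Homology.hasHyperExt_of_isGE`), keyed for instance search (the
generic `IsGE 0` instance does not see through `stupidFiltrationShortComplex`; priority above it).
[folklore] -/
instance (priority := 20000) : HasHyperExt.{0} (zConst ((Opens.toTopCat 𝒳.left.carrier).obj U))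
    (stupidFiltrationShortComplex (extOf 𝒳 U L) n₀ n₁ h).X₃ :=
  hasHyperExt_of_isGE _ _ 0

/-- **Reduction to an open subscheme** (`Homology.HyperExt.exists_smul_delta_eq_zero_of_restrict`
for the restriction to `U`): if the stupid-filtration connecting maps of `L` have torsion image and
the restriction `ℍ^{k₁}(𝒳, Ωⁿ¹[-n₁]) → ℍ^{k₁}(U, Lⁿ¹[-n₁])` has torsion kernel, then the
stupid-filtration connecting maps of `Ω•_{𝒳/R}` have torsion image. [folklore] -/
theorem exists_smul_delta_eq_zero (k₀ k₁ : ℤ) (hk : k₀ + 1 = k₁)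
    (hL : ∀ x' : HyperExt.{0} (zConst ((Opens.toTopCat 𝒳.left.carrier).obj U))
        (stupidFiltrationShortComplex (extOf 𝒳 U L) n₀ n₁ h).X₃ k₀, ∃ m : ℤ, m ≠ 0 ∧
        m • HyperExt.delta (shortExact_stupidFiltrationShortComplex (extOf 𝒳 U L) n₀ n₁ h)
          k₀ k₁ hk x' = 0)
    (hker : ∀ y : HyperExt.{0} (zConst 𝒳.left.carrier)
        (stupidFiltrationShortComplex (extDeRham 𝒳) n₀ n₁ h).X₁ k₁,
        HyperExt.restrictStupidFiltration₁ (res 𝒳 U) (resZConstIso 𝒳 U) (resMap 𝒳 U L gU)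
          n₀ n₁ h k₁ y = 0 → ∃ m : ℤ, m ≠ 0 ∧ m • y = 0)
    (x : HyperExt.{0} (zConst 𝒳.left.carrier)
      (stupidFiltrationShortComplex (extDeRham 𝒳) n₀ n₁ h).X₃ k₀) :
    ∃ m : ℤ, m ≠ 0 ∧
      m • HyperExt.delta (shortExact_stupidFiltrationShortComplex (extDeRham 𝒳) n₀ n₁ h)
        k₀ k₁ hk x = 0 :=
  HyperExt.exists_smul_delta_eq_zero_of_restrict _ _ _ n₀ n₁ h k₀ k₁ hk hL hker x

end OpenReduction

/-! #### The bridge to `HodgeDeRhamDegeneratesModTorsion` and the generic fibre -/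

section Bridge

open OpenReduction

/-- **`HodgeDeRhamDegeneratesModTorsion` from an open reduction**: it suffices to produce, for every
smooth proper `𝒳/W(k)` and all indices, an open `U ⊆ 𝒳`, a complex `L` on `U` with a comparison
`Ω•_{𝒳/W}|_U ⟶ L` whose stupid-filtration connecting maps have torsion image, such that the
restriction on the `Ωⁿ¹[-n₁]` terms has torsion kernel. [folklore] -/
theorem hodgeDeRhamDegeneratesModTorsion_of_openReduction
    (H : ∀ (p : ℕ) [Fact p.Prime] (k : Type) [Field k] [CharP k p] (d : ℕ)
      (𝒳 : SchemeOver (WittVector p k)), IsSmoothProperModel d 𝒳 →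
      ∀ (n₀ n₁ : ℤ) (h : n₀ + 1 = n₁) (k₀ k₁ : ℤ) (hk : k₀ + 1 = k₁),
      ∃ (U : 𝒳.left.Opens) (L : CochainComplex (Sheaf (Opens.grothendieckTopology
          ((Opens.toTopCat 𝒳.left.carrier).obj U)) AddCommGrpCat.{0}) ℕ)
        (gU : ((res 𝒳 U).mapHomologicalComplex (ComplexShape.up ℕ)).obj
          (algebraicDeRhamComplex 𝒳) ⟶ L),
        (∀ x' : HyperExt.{0} (zConst ((Opens.toTopCat 𝒳.left.carrier).obj U))
            (stupidFiltrationShortComplex (extOf 𝒳 U L) n₀ n₁ h).X₃ k₀, ∃ m : ℤ, m ≠ 0 ∧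
            m • HyperExt.delta (shortExact_stupidFiltrationShortComplex (extOf 𝒳 U L) n₀ n₁ h)
              k₀ k₁ hk x' = 0) ∧
        (∀ y : HyperExt.{0} (zConst 𝒳.left.carrier)
            (stupidFiltrationShortComplex (extDeRham 𝒳) n₀ n₁ h).X₁ k₁,
            HyperExt.restrictStupidFiltration₁ (res 𝒳 U) (resZConstIso 𝒳 U) (resMap 𝒳 U L gU)
              n₀ n₁ h k₁ y = 0 → ∃ m : ℤ, m ≠ 0 ∧ m • y = 0)) :
    HodgeDeRhamDegeneratesModTorsion := by
  intro p _ k _ _ d 𝒳 h𝒳 n₀ n₁ h k₀ k₁ hk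
  obtain ⟨U, L, gU, hL, hker⟩ := H p k d 𝒳 h𝒳 n₀ n₁ h k₀ k₁ hk
  intro x
  exact OpenReduction.exists_smul_delta_eq_zero 𝒳 U L gU n₀ n₁ h k₀ k₁ hk hL hker x

end Bridge

section GenericFibre

open OpenReduction

variable {p : ℕ} [Fact p.Prime] {k : Type} [Field k] [CharP k p] (𝒳 : SchemeOver (WittVector p k))

/-- The open subscheme `𝒳[1/p] = D(p) ⊆ 𝒳` (`Motives.baseBasicOpen`; the image of the generic
fibre `X_K ⟶ 𝒳`, `WittScheme.range_genericFibreι_eq_basicOpen`, `WittScheme.exists_iso_basicOpen`).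
[folklore] -/
abbrev genericOpen : 𝒳.left.Opens := baseBasicOpen (p : WittVector p k) 𝒳

/-- `𝒳[1/p]` as a scheme over `K = W(k)[1/p] = Frac W(k)` (`Motives.baseBasicOpenOver`,
`WittScheme.isLocalization_away_fractionRing`). [folklore] -/
def genericOver : SchemeOver (FractionRing (WittVector p k)) :=
  haveI := isLocalization_away_fractionRing (p := p) (k := k)
  baseBasicOpenOver (p : WittVector p k) 𝒳

/-- The algebraic de Rham complex `Ω•_{𝒳[1/p]/K}` of the generic fibre over `K`. [folklore] -/
def genericDeRham : CochainComplex (Sheaf (Opens.grothendieckTopology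
    ((Opens.toTopCat 𝒳.left.carrier).obj (genericOpen 𝒳))) AddCommGrpCat.{0}) ℕ :=
  algebraicDeRhamComplex (genericOver 𝒳)

/-- **`Ω•_{𝒳/W}|_{𝒳[1/p]} ≅ Ω•_{𝒳[1/p]/K}`** (`restrictAlgebraicDeRhamComplexIso`, the de Rham
complex is local, followed by `baseBasicOpenAlgebraicDeRhamComplexIso`, Stacks 00RT along
`W → K = W[1/p]`). [cite: StacksProject, Tag 00RT] -/
def genericDeRhamIso :
    ((res 𝒳 (genericOpen 𝒳)).mapHomologicalComplex (ComplexShape.up ℕ)).obj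
        (algebraicDeRhamComplex 𝒳) ≅ genericDeRham 𝒳 :=
  haveI := isLocalization_away_fractionRing (p := p) (k := k)
  restrictAlgebraicDeRhamComplexIso 𝒳 (genericOpen 𝒳) ≪≫
    baseBasicOpenAlgebraicDeRhamComplexIso (p : WittVector p k) 𝒳

/-- **Reduction of `HodgeDeRhamDegeneratesModTorsion` to the generic fibre.** It follows from
(H1) *degeneration over `K`*: the stupid-filtration (Hodge-to-de Rham) connecting maps of
`Ω•_{𝒳[1/p]/K}` on `𝒳[1/p]` have torsion image (Deligne 1968, Thm. 5.5, for the smooth proper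
`K`-scheme `𝒳[1/p] ≅ X_K`; over a field of characteristic `0` they even vanish), and
(H2) *cohomology and localization*: the restriction `ℍ^{k₁}(𝒳, Ωⁿ¹[-n₁]) → ℍ^{k₁}(𝒳[1/p], Ωⁿ¹[-n₁])`
has torsion kernel (flat base change `H(𝒳, F)[1/p] = H(𝒳[1/p], F|)`, Hartshorne III.9.3 /
EGA III 1.4.15). Both are hypotheses here (no carrier in the tree yet), not named facts; this is
the transport step "Deligne for `X_K/K` + flat base change `W → K`" of the fact's docstring, proved.
[cite: Deligne1968, Thm. 5.5 (ii)] -/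
theorem hodgeDeRhamDegeneratesModTorsion_of_genericFibre
    (H1 : ∀ (p : ℕ) [Fact p.Prime] (k : Type) [Field k] [CharP k p] (d : ℕ)
      (𝒳 : SchemeOver (WittVector p k)), IsSmoothProperModel d 𝒳 →
      ∀ (n₀ n₁ : ℤ) (h : n₀ + 1 = n₁) (k₀ k₁ : ℤ) (hk : k₀ + 1 = k₁)
        (x' : HyperExt.{0} (zConst ((Opens.toTopCat 𝒳.left.carrier).obj (genericOpen 𝒳)))
          (stupidFiltrationShortComplex (extOf 𝒳 (genericOpen 𝒳) (genericDeRham 𝒳)) n₀ n₁ h).X₃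
            k₀),
        ∃ m : ℤ, m ≠ 0 ∧ m • HyperExt.delta (shortExact_stupidFiltrationShortComplex
          (extOf 𝒳 (genericOpen 𝒳) (genericDeRham 𝒳)) n₀ n₁ h) k₀ k₁ hk x' = 0)
    (H2 : ∀ (p : ℕ) [Fact p.Prime] (k : Type) [Field k] [CharP k p] (d : ℕ)
      (𝒳 : SchemeOver (WittVector p k)), IsSmoothProperModel d 𝒳 →
      ∀ (n₀ n₁ : ℤ) (h : n₀ + 1 = n₁) (k₁ : ℤ)
        (y : HyperExt.{0} (zConst 𝒳.left.carrier)
          (stupidFiltrationShortComplex (extDeRham 𝒳) n₀ n₁ h).X₁ k₁),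
        HyperExt.restrictStupidFiltration₁ (res 𝒳 (genericOpen 𝒳)) (resZConstIso 𝒳 (genericOpen 𝒳))
            (resMap 𝒳 (genericOpen 𝒳) (genericDeRham 𝒳) (genericDeRhamIso 𝒳).hom) n₀ n₁ h k₁ y = 0 →
          ∃ m : ℤ, m ≠ 0 ∧ m • y = 0) :
    HodgeDeRhamDegeneratesModTorsion :=
  hodgeDeRhamDegeneratesModTorsion_of_openReduction fun p _ k _ _ d 𝒳 h𝒳 n₀ n₁ h k₀ k₁ hk =>
    ⟨genericOpen 𝒳, genericDeRham 𝒳, (genericDeRhamIso 𝒳).hom,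
      fun x' => H1 p k d 𝒳 h𝒳 n₀ n₁ h k₀ k₁ hk x', fun y hy => H2 p k d 𝒳 h𝒳 n₀ n₁ h k₁ y hy⟩

end GenericFibre

end Literature.AlgebraicGeometry.Crystalline
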